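import Summits.NavierStokesRegularity.FunctionalMining.TopEigGapCoercivePow
import Summits.NavierStokesRegularity.FunctionalMining.StrainCZ
import Literature.Analysis.FunctionSpaces.TorusSobolevGagliardoNirenberg
import HarnessLib

/-!
# FunctionalMining — PROPOSITION L-λ(η) FOR EVERY REAL `q ≥ 2` ON THE WHOLE TOP-GAP CLASS:
# the node `TopEigGapCoercivePos q η` HOLDS for all `2 ≤ q`, `0 < η` (the ceiling `q ≤ 6` removed)

Search for candidate a priori estimates; no regularity claim. Cell `pub-nsfunc`, prove seat
(gen 28). A finite statement about smooth divergence-free zero-mean fields on `T³` and the static heat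
dissipation of `Φ_q = ∫ λ₁(S)^q`; nothing about Navier–Stokes is proved or asserted.

THE POINT. `TopEigGapCoercivePow` settled the dictionary's `@[conjecture]` node
`TopEigGapCoercivePos q η := ∃ c > 0, TopEigHeatCoerciveOnGap q η c` (`TopEigHeatCoerciveGap.lean`; the
no-go seat's Proposition L-λ(η), SIEVELD §3.4b (4)) for `2 ≤ q ≤ 6`, and its module docstring names the one
place where `q ≤ 6` enters: the Sobolev–Hölder brick `∫ ‖u‖² λ₁^{q−2} ≤ K Φ_q(u)`
(`exists_integral_norm_sq_mul_topEig_rpow_le`, through `‖u‖_q ≤ ‖u‖₆ ≲ ‖∇u‖₂`). The main inequality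
`topEigMoment_rpow_le_heatDissipation_of_gap` takes that `K` as a HYPOTHESIS and needs only `2 < q`. This
file supplies the brick for EVERY real `q > 2` (constant depending on `q`) from three tree tools, all typed
for general exponents:
* the Sobolev–Poincaré inequality on `T³` in Bochner form, `(∫‖u‖^r)^{1/r} ≤ C (∫|∇u|^s)^{1/s}` for
  zero-mean smooth `u`, `1 ≤ s < 3`, `1/s − 1/3 ≤ 1/r` (`Torus.exists_integral_rpow_le_gradient_of_hasZeroMean`,
  `Literature/Analysis/FunctionSpaces/TorusSobolevGagliardoNirenberg`, Robinson–Rodrigo–Sadowski 2016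
  Thm 1.7 (i) + 1.9 (iii)) — used at `r = q`, `s = 3q/(q+3) ∈ (6/5, 3)` (the Sobolev exponent of `q`);
* the Calderón–Zygmund / Korn bound `(∫|∇u|^s)^{1/s} ≤ K (∫|S|^s)^{1/s}`, `1 < s`
  (`StrainTensor.exists_gradLs_le_strainLs`, `StrainCZ`);
* the pointwise coercivity `|S| ≤ 6 λ₁` of the top eigenvalue of a trace-free symmetric tensor
  (`TopEig.norm_strainFlat_le`, `TopEigRayleighSpectral`) and Jensen `(∫λ₁^s)^{1/s} ≤ (∫λ₁^q)^{1/q}`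
  (`s < q`, unit volume).
Hence `(∫‖u‖^q)^{2/q} ≤ (6CK)² Φ_q^{2/q}` and, with Hölder `(q/2, q/(q−2))` exactly as in the tree brick,
`∫ ‖u‖² λ₁^{q−2} ≤ (6CK)² Φ_q`.

CONTENT (namespace `Summit.NavierStokesRegularity.FunctionalMining.TopEig`):
* `rpow_integral_topEig_rpow_le` — Jensen `(∫λ₁^s)^{1/s} ≤ Φ_q^{1/q}`, `0 < s < q`;
* `rpow_integral_strain_rpow_le` — `(∫|S|^s)^{1/s} ≤ 6 (∫λ₁^s)^{1/s}`, `0 < s`;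
* `rpow_integral_norm_rpow_le_topEigMoment` — `(∫‖u‖^q)^{1/q} ≤ 6CK · Φ_q^{1/q}` for every real `q > 2`
  (`C`, `K` the two tree constants at `s = 3q/(q+3)`);
* **`exists_integral_norm_sq_mul_topEig_rpow_le_of_two_lt (hq : 2 < q)`** — the brick for every real
  `q > 2`: `∃ K ≥ 0, ∀ u` smooth divergence-free zero-mean, `∫ ‖u‖² λ₁^{q−2} ≤ K Φ_q(u)`;
* **`topEigGapCoercivePos_of_gt_two (2 < q) (0 < η) : TopEigGapCoercivePos (d := Fin 3) q η`** and
  **`topEigGapCoercivePos_of_ge_two (2 ≤ q) (0 < η)`** — the node for EVERY real `q ≥ 2`;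
* `violators_outside_every_gap_of_not_pos_of_ge_two` — SIEVELD's COROLLARY, unconditional for every real
  `q ≥ 2`: if L-λ(q) fails, violators live outside EVERY top-gap class (near-biaxial points).
The rate is existential (it contains the tree's Sobolev–Poincaré and Calderón–Zygmund constants at the
`q`-dependent exponent `s = 3q/(q+3)`). NOT CLAIMED: `q < 2` (there `λ₁^{q−2}` is unbounded at the zeros of
`λ₁`; the gap class below `2` is the dictionary's (LL) programme), any value of the best constant, the
one-sided node `TopEigHeatCoercivePos q` (OPEN in the kernel for every real `q > 1`), Navier–Stokes
regularity. [ours; the no-go seat's Proposition L-λ(η) (pen range `2 ≤ q ≤ 6`), kernel for all `q ≥ 2`]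
-/

noncomputable section

open Filter Topology Finset MeasureTheory
open scoped ContDiff

namespace Summit.NavierStokesRegularity.FunctionalMining

open Literature.Analysis Literature.Analysis.FunctionSpaces Literature.Analysis.FunctionSpaces.Torus
  Literature.Analysis.Matrix

namespace TopEig

open StrainL4 StrainTensor

variable {v : UnitAddTorus (Fin 3) → EuclideanSpace ℝ (Fin 3)}

/-! ## 1. Two Jensen / coercivity steps on the strain side -/

/-- Jensen on the unit torus for the top eigenvalue: `(∫ λ₁^s)^{1/s} ≤ Φ_q^{1/q}` for `0 < s < q` and a
smooth divergence-free `v` (`λ₁ ≥ 0`, `Φ_q = ∫ λ₁^q`). [folklore] -/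
theorem rpow_integral_topEig_rpow_le (hv : Torus.IsSmooth v) (hdiv : Torus.IsDivFree v)
    {s q : ℝ} (hs : 0 < s) (hsq : s < q) :
    (∫ x, torusStrainTopEig v x ^ s) ^ (1 / s) ≤ torusTopEigMoment q v ^ (1 / q) := by
  have hl0 : ∀ x, 0 ≤ torusStrainTopEig v x := fun x => by
    rw [← lam_strainFlat]; exact lam_strainFlat_nonneg hv hdiv x
  have hlc : Continuous (torusStrainTopEig v) := continuous_torusStrainTopEig hv
  have hq0 : 0 < q := hs.trans hsq
  have hp : (q / s).HolderConjugate (Real.conjExponent (q / s)) :=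
    Real.HolderConjugate.conjExponent (by rw [lt_div_iff₀ hs]; linarith)
  have hf : MemLp (fun x => torusStrainTopEig v x ^ s) (ENNReal.ofReal (q / s)) volume :=
    (hlc.rpow_const fun x => Or.inr hs.le).memLp_of_hasCompactSupport (HasCompactSupport.of_compactSpace _)
  have hg : MemLp (fun _ : UnitAddTorus (Fin 3) => (1 : ℝ)) (ENNReal.ofReal (Real.conjExponent (q / s)))
      volume := continuous_const.memLp_of_hasCompactSupport (HasCompactSupport.of_compactSpace _)
  have hH := integral_mul_le_Lp_mul_Lq_of_nonneg (μ := volume) hp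
    (ae_of_all _ fun x => Real.rpow_nonneg (hl0 x) _) (ae_of_all _ fun _ => zero_le_one) hf hg
  have e2 : ∫ x, (torusStrainTopEig v x ^ s) ^ (q / s) = torusTopEigMoment q v := by
    rw [torusTopEigMoment_eq hv hdiv q]
    refine integral_congr_ae (ae_of_all _ fun x => ?_)
    dsimp only
    rw [← Real.rpow_mul (hl0 x), show s * (q / s) = q by field_simp, lam_strainFlat]
  have e3 : (∫ x, (1 : ℝ) ^ Real.conjExponent (q / s) ∂(volume : Measure (UnitAddTorus (Fin 3)))) ^
      (1 / Real.conjExponent (q / s)) = 1 := by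
    simp [Real.one_rpow]
  simp only [mul_one] at hH
  rw [e2, e3, mul_one, one_div, inv_div] at hH
  have hI0 : 0 ≤ ∫ x, torusStrainTopEig v x ^ s := integral_nonneg fun x => Real.rpow_nonneg (hl0 x) _
  have hF0 : 0 ≤ torusTopEigMoment q v := torusTopEigMoment_nonneg q v
  calc (∫ x, torusStrainTopEig v x ^ s) ^ (1 / s) ≤ (torusTopEigMoment q v ^ (s / q)) ^ (1 / s) :=
        Real.rpow_le_rpow hI0 hH (by positivity)
    _ = torusTopEigMoment q v ^ (1 / q) := by
        rw [← Real.rpow_mul hF0]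
        congr 1
        field_simp

/-- **`(∫ |S|^s)^{1/s} ≤ 6 (∫ λ₁^s)^{1/s}`** (`0 < s`) for a smooth divergence-free `v` on `T³`: the
pointwise coercivity `|S| ≤ 6λ₁` of the top eigenvalue of a trace-free symmetric tensor
(`norm_strainFlat_le`), integrated. [ours, bookkeeping] -/
theorem rpow_integral_strain_rpow_le (hv : Torus.IsSmooth v) (hdiv : Torus.IsDivFree v) {s : ℝ}
    (hs : 0 < s) :
    (∫ x, Real.sqrt (torusStrainSqAt v x) ^ s) ^ (1 / s) ≤
      6 * (∫ x, torusStrainTopEig v x ^ s) ^ (1 / s) := by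
  have hl0 : ∀ x, 0 ≤ torusStrainTopEig v x := fun x => by
    rw [← lam_strainFlat]; exact lam_strainFlat_nonneg hv hdiv x
  have hlc : Continuous (torusStrainTopEig v) := continuous_torusStrainTopEig hv
  have hpt : ∀ x, Real.sqrt (torusStrainSqAt v x) ^ s ≤ (6 : ℝ) ^ s * torusStrainTopEig v x ^ s := by
    intro x
    rw [← norm_strainFlat_eq_sqrt, ← Real.mul_rpow (by norm_num) (hl0 x), ← lam_strainFlat]
    exact Real.rpow_le_rpow (norm_nonneg _) (norm_strainFlat_le hv hdiv x) hs.le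
  have hint : ∫ x, Real.sqrt (torusStrainSqAt v x) ^ s ≤ (6 : ℝ) ^ s * ∫ x, torusStrainTopEig v x ^ s := by
    rw [← integral_const_mul]
    exact integral_mono_of_nonneg (ae_of_all _ fun x => Real.rpow_nonneg (Real.sqrt_nonneg _) _)
      (((hlc.rpow_const fun x => Or.inr hs.le).const_mul _).integrable_unitAddTorus)
      (ae_of_all _ hpt)
  have hI0 : 0 ≤ ∫ x, Real.sqrt (torusStrainSqAt v x) ^ s :=
    integral_nonneg fun x => Real.rpow_nonneg (Real.sqrt_nonneg _) _
  have hJ0 : 0 ≤ ∫ x, torusStrainTopEig v x ^ s := integral_nonneg fun x => Real.rpow_nonneg (hl0 x) _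
  calc (∫ x, Real.sqrt (torusStrainSqAt v x) ^ s) ^ (1 / s)
      ≤ ((6 : ℝ) ^ s * ∫ x, torusStrainTopEig v x ^ s) ^ (1 / s) := Real.rpow_le_rpow hI0 hint (by positivity)
    _ = 6 * (∫ x, torusStrainTopEig v x ^ s) ^ (1 / s) := by
        rw [Real.mul_rpow (by positivity) hJ0, ← Real.rpow_mul (by norm_num : (0 : ℝ) ≤ 6),
          show s * (1 / s) = 1 by field_simp, Real.rpow_one]

/-! ## 2. The velocity side for every real `q > 2`: Sobolev–Poincaré at the Sobolev exponent of `q` -/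

/-- The Sobolev exponent of `q`: for `2 < q`, `s := 3q/(q+3)` satisfies `1 < s < 3`, `s < q` and
`1/s − 1/3 = 1/q`. [folklore, bookkeeping] -/
theorem sobolevExponent_bookkeeping {q : ℝ} (hq : 2 < q) :
    1 < 3 * q / (q + 3) ∧ 3 * q / (q + 3) < 3 ∧ 3 * q / (q + 3) < q ∧
      1 / (3 * q / (q + 3)) - 1 / 3 = 1 / q := by
  have hq3 : 0 < q + 3 := by linarith
  have hq0 : 0 < q := by linarith
  refine ⟨by rw [lt_div_iff₀ hq3]; linarith, by rw [div_lt_iff₀ hq3]; linarith,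
    by rw [div_lt_iff₀ hq3]; nlinarith, ?_⟩
  field_simp
  ring

/-- **`(∫ ‖u‖^q)^{1/q} ≤ 6·C·K · Φ_q(u)^{1/q}` for every real `q > 2`**, `u` smooth, divergence free and
zero mean on `T³`, where `C` is the tree's Sobolev–Poincaré constant and `K` its Calderón–Zygmund
constant at the exponent `s = 3q/(q+3)`: `‖u‖_q ≤ C‖∇u‖_s ≤ CK‖S‖_s ≤ 6CK‖λ₁‖_s ≤ 6CK‖λ₁‖_q`. [ours] -/
theorem rpow_integral_norm_rpow_le_topEigMoment {q : ℝ} (hq : 2 < q) :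
    ∃ M : ℝ, 0 ≤ M ∧ ∀ (u : UnitAddTorus (Fin 3) → EuclideanSpace ℝ (Fin 3)), Torus.IsSmooth u →
      Torus.IsDivFree u → Torus.HasZeroMean u →
        (∫ x, ‖u x‖ ^ q) ^ (1 / q) ≤ M * torusTopEigMoment q u ^ (1 / q) := by
  have hq0 : 0 < q := by linarith
  obtain ⟨hs1, hs3, hsq, hsr⟩ := sobolevExponent_bookkeeping hq
  set s : ℝ := 3 * q / (q + 3) with hs_def
  have hs0 : 0 < s := by linarith
  obtain ⟨C, hC0, hC⟩ := Torus.exists_integral_rpow_le_gradient_of_hasZeroMean (d := Fin 3)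
    (F' := EuclideanSpace ℝ (Fin 3)) (by simp) hs1.le hs3 hq0 hsr.le
  obtain ⟨K, hK0, hK⟩ := StrainTensor.exists_gradLs_le_strainLs hs1
  refine ⟨6 * C * K, by positivity, fun u hu hdiv hmean => ?_⟩
  have h1 := hC u hu hmean
  have h2 := hK u hu hdiv
  have h3 := rpow_integral_strain_rpow_le hu hdiv hs0
  have h4 := rpow_integral_topEig_rpow_le hu hdiv hs0 hsq
  have hS0 : 0 ≤ (∫ x, Real.sqrt (torusStrainSqAt u x) ^ s) ^ (1 / s) :=
    Real.rpow_nonneg (integral_nonneg fun x => Real.rpow_nonneg (Real.sqrt_nonneg _) _) _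
  have hF0 : 0 ≤ torusTopEigMoment q u ^ (1 / q) := Real.rpow_nonneg (torusTopEigMoment_nonneg q u) _
  calc (∫ x, ‖u x‖ ^ q) ^ (1 / q)
      ≤ C * (∫ x, Real.sqrt (∑ j, ‖Torus.partialDeriv j u x‖ ^ 2) ^ s) ^ (1 / s) := h1
    _ ≤ C * (K * (∫ x, Real.sqrt (torusStrainSqAt u x) ^ s) ^ (1 / s)) :=
        mul_le_mul_of_nonneg_left h2 hC0
    _ ≤ C * (K * (6 * torusTopEigMoment q u ^ (1 / q))) := by
        gcongr
        exact h3.trans (by nlinarith)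
    _ = 6 * C * K * torusTopEigMoment q u ^ (1 / q) := by ring

/-- **THE SOBOLEV–HÖLDER BRICK FOR EVERY REAL `q > 2`.** There is `K ≥ 0` (depending on `q`) such that
for every smooth, divergence-free, zero-mean `u` on `T³`: `∫ ‖u‖² λ₁^{q−2} ≤ K · Φ_q(u)`. Chain: Hölder
`(q/2, q/(q−2))`, `(∫‖u‖^q)^{2/q} ≤ (6CK)² Φ_q^{2/q}` (`rpow_integral_norm_rpow_le_topEigMoment`), and
`Φ_q^{2/q}·Φ_q^{(q−2)/q} = Φ_q`. The tree's `exists_integral_norm_sq_mul_topEig_rpow_le` is the case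
`q ≤ 6` with a `q`-uniform constant. [ours] -/
theorem exists_integral_norm_sq_mul_topEig_rpow_le_of_two_lt {q : ℝ} (hq : 2 < q) :
    ∃ K : ℝ, 0 ≤ K ∧ ∀ (u : UnitAddTorus (Fin 3) → EuclideanSpace ℝ (Fin 3)), Torus.IsSmooth u →
      Torus.IsDivFree u → Torus.HasZeroMean u →
        ∫ x, ‖u x‖ ^ 2 * torusStrainTopEig u x ^ (q - 2) ≤ K * torusTopEigMoment q u := by
  obtain ⟨M, hM0, hM⟩ := rpow_integral_norm_rpow_le_topEigMoment hq
  refine ⟨M ^ 2, by positivity, fun u hu hdiv hmean => ?_⟩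
  have hq0 : 0 < q := by linarith
  have hq2 : 0 < q - 2 := by linarith
  have hl0 : ∀ x, 0 ≤ torusStrainTopEig u x := fun x => by
    rw [← lam_strainFlat]; exact lam_strainFlat_nonneg hu hdiv x
  have hlc : Continuous (torusStrainTopEig u) := continuous_torusStrainTopEig hu
  have huc : Continuous u := hu.continuous
  have hF0 : 0 ≤ torusTopEigMoment q u := torusTopEigMoment_nonneg q u
  -- Hölder `(q/2, q/(q−2))`
  have hp : (q / 2).HolderConjugate (q / (q - 2)) := by
    rw [Real.holderConjugate_iff]
    refine ⟨by rw [lt_div_iff₀ two_pos]; linarith, ?_⟩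
    field_simp
    ring
  have hf : MemLp (fun x => ‖u x‖ ^ 2) (ENNReal.ofReal (q / 2)) volume :=
    (huc.norm.pow 2).memLp_of_hasCompactSupport (HasCompactSupport.of_compactSpace _)
  have hg : MemLp (fun x => torusStrainTopEig u x ^ (q - 2)) (ENNReal.ofReal (q / (q - 2))) volume :=
    (hlc.rpow_const fun x => Or.inr hq2.le).memLp_of_hasCompactSupport (HasCompactSupport.of_compactSpace _)
  have hH := integral_mul_le_Lp_mul_Lq_of_nonneg (μ := volume) hp
    (ae_of_all _ fun x => sq_nonneg _) (ae_of_all _ fun x => Real.rpow_nonneg (hl0 x) _) hf hg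
  have eA : ∫ x, (‖u x‖ ^ 2) ^ (q / 2) = ∫ x, ‖u x‖ ^ q := by
    refine integral_congr_ae (ae_of_all _ fun x => ?_)
    dsimp only
    rw [← Real.rpow_natCast, ← Real.rpow_mul (norm_nonneg _)]
    congr 1; push_cast; field_simp
  have eB : ∫ x, (torusStrainTopEig u x ^ (q - 2)) ^ (q / (q - 2)) = torusTopEigMoment q u := by
    rw [torusTopEigMoment_eq hu hdiv q]
    refine integral_congr_ae (ae_of_all _ fun x => ?_)
    dsimp only
    rw [← Real.rpow_mul (hl0 x), show (q - 2) * (q / (q - 2)) = q by field_simp, lam_strainFlat]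
  rw [eA, eB, one_div, one_div, inv_div, inv_div] at hH
  -- the velocity factor
  have hI0 : 0 ≤ ∫ x, ‖u x‖ ^ q := integral_nonneg fun x => Real.rpow_nonneg (norm_nonneg _) _
  have hV := hM u hu hdiv hmean
  have hV2 : (∫ x, ‖u x‖ ^ q) ^ (2 / q) ≤ M ^ 2 * torusTopEigMoment q u ^ (2 / q) := by
    have e1 : (∫ x, ‖u x‖ ^ q) ^ (2 / q) = ((∫ x, ‖u x‖ ^ q) ^ (1 / q)) ^ 2 := by
      rw [← Real.rpow_natCast, ← Real.rpow_mul hI0]; congr 1; push_cast; ring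
    have e2 : torusTopEigMoment q u ^ (2 / q) = (torusTopEigMoment q u ^ (1 / q)) ^ 2 := by
      rw [← Real.rpow_natCast, ← Real.rpow_mul hF0]; congr 1; push_cast; ring
    rw [e1, e2, ← mul_pow]
    exact pow_le_pow_left₀ (Real.rpow_nonneg hI0 _) hV 2
  have hqne : q ≠ 0 := hq0.ne'
  have hsum : 2 / q + (q - 2) / q = 1 := by field_simp; ring
  have hE : torusTopEigMoment q u ^ (2 / q) * torusTopEigMoment q u ^ ((q - 2) / q) =
      torusTopEigMoment q u := by
    rw [← Real.rpow_add' hF0 (by rw [hsum]; exact one_ne_zero), hsum, Real.rpow_one]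
  calc ∫ x, ‖u x‖ ^ 2 * torusStrainTopEig u x ^ (q - 2)
      ≤ (∫ x, ‖u x‖ ^ q) ^ (2 / q) * torusTopEigMoment q u ^ ((q - 2) / q) := hH
    _ ≤ M ^ 2 * torusTopEigMoment q u ^ (2 / q) * torusTopEigMoment q u ^ ((q - 2) / q) :=
        mul_le_mul_of_nonneg_right hV2 (Real.rpow_nonneg hF0 _)
    _ = M ^ 2 * torusTopEigMoment q u := by rw [mul_assoc, hE]

/-! ## 3. The node for every real `q ≥ 2` -/

/-- **THE NODE `TopEigGapCoercivePos q η` FOR EVERY REAL `q > 2` AND EVERY `η > 0`** — Proposition L-λ(η)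
at exponent `q` on the whole top-gap class, existential rate, with no ceiling on `q`
(`topEigMoment_rpow_le_heatDissipation_of_gap` fed with the brick of this file). [ours; the no-go seat's
Proposition L-λ(η) (SIEVELD §3.4b (4)) beyond its pen range `q ≤ 6`, kernel] -/
theorem topEigGapCoercivePos_of_gt_two {q η : ℝ} (hq : 2 < q) (hη0 : 0 < η) :
    TopEigGapCoercivePos (d := Fin 3) q η := by
  -- first `0 < η ≤ 1`, then larger `η` by monotonicity of the class
  suffices h : ∀ η' : ℝ, 0 < η' → η' ≤ 1 → TopEigGapCoercivePos (d := Fin 3) q η' by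
    rcases le_or_gt η 1 with h1 | h1
    · exact h η hη0 h1
    · exact (h 1 one_pos le_rfl).of_le_eta h1.le
  intro η' hη0' hη1'
  obtain ⟨K, hK0, hK⟩ := exists_integral_norm_sq_mul_topEig_rpow_le_of_two_lt hq
  refine ⟨η' * q / (3 * (q - 1) * (K + 1)), by
    have : 0 < 3 * (q - 1) * (K + 1) := by nlinarith
    have : 0 < η' * q := by nlinarith
    positivity, ?_⟩
  intro _ u hu hdiv hmean hcls
  exact topEigMoment_rpow_le_heatDissipation_of_gap hu hdiv hq hη0' hη1' hcls hK0 (hK u hu hdiv hmean)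

/-- **THE NODE `TopEigGapCoercivePos q η` FOR EVERY REAL `q ≥ 2`, `η > 0`** (`q = 2`:
`topEigGapCoercivePos_two`; `2 < q`: `topEigGapCoercivePos_of_gt_two`). [ours] -/
theorem topEigGapCoercivePos_of_ge_two {q η : ℝ} (hq : 2 ≤ q) (hη0 : 0 < η) :
    TopEigGapCoercivePos (d := Fin 3) q η := by
  rcases hq.eq_or_lt with h2 | h2
  · rw [← h2]; exact topEigGapCoercivePos_two hη0
  · exact topEigGapCoercivePos_of_gt_two h2 hη0

/-- **THE COROLLARY OF SIEVELD §3.4b, UNCONDITIONAL FOR EVERY REAL `q ≥ 2`.** If Lemma L-λ(q)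
(`TopEigHeatCoercivePos q`, the one-sided open node) FAILS, then for EVERY gap parameter `η > 0` and every
small rate the violators live OUTSIDE the class `λ₂ ≤ (1−η)λ₁`: a violating sequence develops near-biaxial
points `λ₂ ≈ λ₁` (the dictionary's `violators_outside_gap_of_not_pos` fed with
`topEigGapCoercivePos_of_ge_two`). [ours] -/
theorem violators_outside_every_gap_of_not_pos_of_ge_two {q η : ℝ} (hq : 2 ≤ q) (hη0 : 0 < η)
    (hfail : ¬ TopEigHeatCoercivePos (d := Fin 3) q) :
    ∃ c₀ : ℝ, 0 < c₀ ∧ ∀ c : ℝ, 0 < c → c ≤ c₀ →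
      ∃ v : UnitAddTorus (Fin 3) → EuclideanSpace ℝ (Fin 3), Torus.IsSmooth v ∧ Torus.IsDivFree v ∧
        Torus.HasZeroMean v ∧ ¬ StrainGapClass η v ∧
        heatDissipation (torusTopEigMoment q) v < c * torusTopEigMoment q v :=
  violators_outside_gap_of_not_pos (topEigGapCoercivePos_of_ge_two hq hη0) hfail

end TopEig

end Summit.NavierStokesRegularity.FunctionalMining

end
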